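import Literature.NumberTheory.Transcendental.ExpPointsGeometryBasic
import Mathlib.Analysis.Calculus.Deriv.Star
import Mathlib.Analysis.Complex.CauchyIntegral
import Mathlib.Analysis.SpecialFunctions.Pow.Real
import Mathlib.Analysis.SpecialFunctions.Complex.Log
import HarnessLib

/-!
# The normalised cusp ray of a curve of exponential points

From the cusp form of a log-free end (`ExpPointsLogFreeUniformize`),
`𝔠_ε(s) = ((2πi ε s⁻ᵉ + ℓu(s), 2πi (A(s⁻¹) + g(s)) + ℓv(s)), (e^{ℓu(s)}, e^{ℓv(s)})) ∈ W`,
`ε = ±1`, with infinitely many independent exponential points at real positive parameters, to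
the NORMALISED form `ε = 1` (`exists_normalised_cusp`): for `ε = -1` one passes to the
complex-conjugate branch `s ↦ conj (𝔠_{-1}(conj s))`, which lies in `W` because a set defined
over `ℚ` is stable under conjugation (`ExpPointsGeometryBasic`), and which carries the conjugate
hits (again independent exponential points). Finally the real hits `s = ρ` are INTEGER POINTS of
the cusp germ: `ρ⁻ᵉ = N ∈ ℕ` and `A(N^{1/e}) + g(N^{-1/e}) ∈ ℤ` (`infinite_nat_hits`), which is
the shape of the open arithmetic problem (integer values of a period-twisted analytic germ at
infinity). PROVED, no definition. [folklore]
-/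

noncomputable section

open Complex Filter Topology Set Metric Polynomial
open scoped Real ComplexConjugate

namespace Literature.NumberTheory.Transcendental

/-- The normalised cusp form `((2πi s⁻ᵉ + ℓu s, 2πi (A(s⁻¹) + g s) + ℓv s), (e^{ℓu s}, e^{ℓv s}))`
(local notation). -/
local notation3 "𝔠₁[" e ", " A ", " g ", " ℓu ", " ℓv ", " s "]" =>
  (Sum.elim ![2 * (Real.pi : ℂ) * I * (s : ℂ)⁻¹ ^ (e : ℕ) + (ℓu : ℂ → ℂ) s,
      2 * (Real.pi : ℂ) * I * (Polynomial.eval s⁻¹ (A : ℂ[X]) + (g : ℂ → ℂ) s) + (ℓv : ℂ → ℂ) s]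
    ![Complex.exp ((ℓu : ℂ → ℂ) s), Complex.exp ((ℓv : ℂ → ℂ) s)] : Fin 2 ⊕ Fin 2 → ℂ)

/-- The cusp form with a sign `ε` (local notation). -/
local notation3 "𝔠[" ε ", " e ", " A ", " g ", " ℓu ", " ℓv ", " s "]" =>
  (Sum.elim ![2 * (Real.pi : ℂ) * I * (ε : ℂ) * (s : ℂ)⁻¹ ^ (e : ℕ) + (ℓu : ℂ → ℂ) s,
      2 * (Real.pi : ℂ) * I * (Polynomial.eval s⁻¹ (A : ℂ[X]) + (g : ℂ → ℂ) s) + (ℓv : ℂ → ℂ) s]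
    ![Complex.exp ((ℓu : ℂ → ℂ) s), Complex.exp ((ℓv : ℂ → ℂ) s)] : Fin 2 ⊕ Fin 2 → ℂ)

/-! ### Conjugate germs -/

/-- `s ↦ conj (f (conj s))` is analytic at `0` if `f` is. [folklore] -/
theorem analyticAt_conj_conj {f : ℂ → ℂ} (hf : AnalyticAt ℂ f 0) :
    AnalyticAt ℂ (fun s => conj (f (conj s))) 0 := by
  rw [Complex.analyticAt_iff_eventually_differentiableAt] at hf ⊢
  have h0 : Tendsto (conj : ℂ → ℂ) (𝓝 0) (𝓝 0) := by
    have := Complex.continuous_conj.tendsto (0 : ℂ)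
    simpa using this
  filter_upwards [h0.eventually hf] with z hz
  have := hz.conj_conj
  rw [Complex.conj_conj] at this
  exact this

/-- Conjugating the value of a polynomial. [folklore] -/
theorem conj_eval (A : ℂ[X]) (y : ℂ) : conj (A.eval y) = (A.map (starRingEnd ℂ)).eval (conj y) := by
  rw [Polynomial.eval_map, ← Polynomial.eval₂_hom]

/-- `conj (2πi) = -2πi`. [folklore] -/
theorem conj_two_pi_I : conj (2 * (Real.pi : ℂ) * I) = -(2 * (Real.pi : ℂ) * I) := by
  rw [map_mul, map_mul, Complex.conj_ofReal, Complex.conj_I, show (2 : ℂ) = ((2 : ℝ) : ℂ) by norm_num,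
    Complex.conj_ofReal]
  ring

/-! ### Integer points from real hits -/

/-- **Real hits are integer points of the cusp germ.** If infinitely many independent exponential
points are of the form `(x, eˣ) = 𝔠₁(ρ)` with real `0 < ρ < δ` (for every `δ > 0`), then the set
of `N ∈ ℕ` such that the ray point at `s = N^{-1/e}` is an independent exponential point lying on
the branch with `A(N^{1/e}) + g(N^{-1/e}) ∈ ℤ` is infinite. [folklore] -/
theorem infinite_nat_hits {W : Set (Fin 2 ⊕ Fin 2 → ℂ)} {e : ℕ} (he : 0 < e) {A : ℂ[X]}
    {g ℓu ℓv : ℂ → ℂ}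
    (hhit : ∀ δ : ℝ, 0 < δ → Set.Infinite {x | x ∈ indepExpPoints W ∧ ∃ ρ : ℝ, 0 < ρ ∧ ρ < δ ∧
      Sum.elim x (Complex.exp ∘ x) = 𝔠₁[e, A, g, ℓu, ℓv, (ρ : ℂ)]}) :
    Set.Infinite {N : ℕ |
      (![2 * ↑π * I * (N : ℂ) + ℓu ((((N : ℝ) ^ ((e : ℝ)⁻¹) : ℝ) : ℂ))⁻¹,
          2 * ↑π * I * (A.eval ((((N : ℝ) ^ ((e : ℝ)⁻¹) : ℝ) : ℂ)) +
            g ((((N : ℝ) ^ ((e : ℝ)⁻¹) : ℝ) : ℂ))⁻¹) + ℓv ((((N : ℝ) ^ ((e : ℝ)⁻¹) : ℝ) : ℂ))⁻¹] :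
          Fin 2 → ℂ) ∈ indepExpPoints W ∧
      Complex.exp ∘ (![2 * ↑π * I * (N : ℂ) + ℓu ((((N : ℝ) ^ ((e : ℝ)⁻¹) : ℝ) : ℂ))⁻¹,
          2 * ↑π * I * (A.eval ((((N : ℝ) ^ ((e : ℝ)⁻¹) : ℝ) : ℂ)) +
            g ((((N : ℝ) ^ ((e : ℝ)⁻¹) : ℝ) : ℂ))⁻¹) + ℓv ((((N : ℝ) ^ ((e : ℝ)⁻¹) : ℝ) : ℂ))⁻¹] :
          Fin 2 → ℂ) =
        ![Complex.exp (ℓu ((((N : ℝ) ^ ((e : ℝ)⁻¹) : ℝ) : ℂ))⁻¹),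
          Complex.exp (ℓv ((((N : ℝ) ^ ((e : ℝ)⁻¹) : ℝ) : ℂ))⁻¹)] ∧
      ∃ L : ℤ, A.eval ((((N : ℝ) ^ ((e : ℝ)⁻¹) : ℝ) : ℂ)) +
        g ((((N : ℝ) ^ ((e : ℝ)⁻¹) : ℝ) : ℂ))⁻¹ = L} := by
  classical
  have h2πI : (2 * (Real.pi : ℂ) * I) ≠ 0 := by simp [Real.pi_ne_zero, I_ne_zero]
  intro hfin
  apply hhit 1 one_pos
  -- every real hit is the ray point of some `N` in the (finite) set
  refine (hfin.image fun N : ℕ => (![2 * ↑π * I * (N : ℂ) + ℓu ((((N : ℝ) ^ ((e : ℝ)⁻¹) : ℝ) : ℂ))⁻¹,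
      2 * ↑π * I * (A.eval ((((N : ℝ) ^ ((e : ℝ)⁻¹) : ℝ) : ℂ)) +
        g ((((N : ℝ) ^ ((e : ℝ)⁻¹) : ℝ) : ℂ))⁻¹) + ℓv ((((N : ℝ) ^ ((e : ℝ)⁻¹) : ℝ) : ℂ))⁻¹] :
      Fin 2 → ℂ)).subset ?_
  rintro x ⟨hxH, ρ, hρ, -, hpt⟩
  have hx0 : x 0 = 2 * ↑π * I * (ρ : ℂ)⁻¹ ^ e + ℓu ρ := by
    have := congrFun hpt (Sum.inl 0); simpa using this
  have hx1 : x 1 = 2 * ↑π * I * (A.eval (ρ : ℂ)⁻¹ + g ρ) + ℓv ρ := by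
    have := congrFun hpt (Sum.inl 1); simpa using this
  have hex0 : exp (x 0) = exp (ℓu ρ) := by
    have := congrFun hpt (Sum.inr 0); simpa using this
  have hex1 : exp (x 1) = exp (ℓv ρ) := by
    have := congrFun hpt (Sum.inr 1); simpa using this
  -- `ρ⁻ᵉ = k ∈ ℤ`, `k > 0`
  have hone0 : exp (2 * ↑π * I * (ρ : ℂ)⁻¹ ^ e) = 1 := by
    have : 2 * ↑π * I * (ρ : ℂ)⁻¹ ^ e = x 0 - ℓu ρ := by rw [hx0]; ring
    rw [this, Complex.exp_sub, hex0, div_self (Complex.exp_ne_zero _)]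
  obtain ⟨k, hk⟩ := Complex.exp_eq_one_iff.1 hone0
  have hk' : ((ρ : ℂ)⁻¹ ^ e) = (k : ℂ) := by
    rw [mul_comm (k : ℂ)] at hk
    exact mul_left_cancel₀ h2πI hk
  have hkreal : ((ρ⁻¹ ^ e : ℝ) : ℂ) = ((k : ℝ) : ℂ) := by push_cast; exact hk'
  have hkr : (k : ℝ) = ρ⁻¹ ^ e := by exact_mod_cast hkreal.symm
  have hkpos : 0 < k := by
    have : (0 : ℝ) < k := by rw [hkr]; positivity
    exact_mod_cast this
  set N : ℕ := k.toNat with hN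
  have hNk : (N : ℤ) = k := Int.toNat_of_nonneg hkpos.le
  have hNreal : (N : ℝ) = ρ⁻¹ ^ e := by
    rw [← hkr]; exact_mod_cast hNk
  have hNcx : (N : ℂ) = (ρ : ℂ)⁻¹ ^ e := by
    rw [hk']; exact_mod_cast hNk
  have hw : ((N : ℝ) ^ ((e : ℝ)⁻¹) : ℝ) = ρ⁻¹ := by
    rw [hNreal]; exact Real.pow_rpow_inv_natCast (inv_nonneg.2 hρ.le) he.ne'
  have hwc : ((((N : ℝ) ^ ((e : ℝ)⁻¹) : ℝ) : ℂ)) = (ρ : ℂ)⁻¹ := by rw [hw]; push_cast; rfl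
  have hwci : ((((N : ℝ) ^ ((e : ℝ)⁻¹) : ℝ) : ℂ))⁻¹ = (ρ : ℂ) := by rw [hwc, inv_inv]
  -- integrality of the germ value
  have hone1 : exp (2 * ↑π * I * (A.eval (ρ : ℂ)⁻¹ + g ρ)) = 1 := by
    have : 2 * ↑π * I * (A.eval (ρ : ℂ)⁻¹ + g ρ) = x 1 - ℓv ρ := by rw [hx1]; ring
    rw [this, Complex.exp_sub, hex1, div_self (Complex.exp_ne_zero _)]
  obtain ⟨L, hL⟩ := Complex.exp_eq_one_iff.1 hone1
  have hL' : A.eval (ρ : ℂ)⁻¹ + g ρ = L := by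
    rw [mul_comm (L : ℂ)] at hL
    exact mul_left_cancel₀ h2πI hL
  -- `x` is the ray point of `N`
  have hxeq : x = ![2 * ↑π * I * (N : ℂ) + ℓu ((((N : ℝ) ^ ((e : ℝ)⁻¹) : ℝ) : ℂ))⁻¹,
      2 * ↑π * I * (A.eval ((((N : ℝ) ^ ((e : ℝ)⁻¹) : ℝ) : ℂ)) +
        g ((((N : ℝ) ^ ((e : ℝ)⁻¹) : ℝ) : ℂ))⁻¹) + ℓv ((((N : ℝ) ^ ((e : ℝ)⁻¹) : ℝ) : ℂ))⁻¹] := by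
    rw [hwci, hwc, hNcx]
    funext j; fin_cases j
    · simpa using hx0
    · simpa using hx1
  refine ⟨N, ⟨?_, ?_, L, ?_⟩, hxeq.symm⟩
  · rw [← hxeq]; exact hxH
  · rw [← hxeq, hwci]
    funext j; fin_cases j
    · simpa using hex0
    · simpa using hex1
  · rw [hwci, hwc]; exact hL'

/-! ### Normalisation of the sign -/

/-- **The normalised cusp ray.** From the cusp form with sign `ε = ±1` (branch in `W` for
`0 < |s| < ρ₀`, infinitely many independent exponential points at real parameters `0 < ρ < δ`
for every `δ`), for `W` defined over `ℚ`, one obtains the same with `ε = 1` (conjugating the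
branch if `ε = -1`). [folklore] -/
theorem exists_normalised_cusp {W : Set (Fin 2 ⊕ Fin 2 → ℂ)} (hW : IsDefinedOver (⊥ : Subfield ℂ) W)
    {e : ℕ} {ε : ℂ} {A : ℂ[X]} {g ℓu ℓv : ℂ → ℂ} {ρ₀ : ℝ} (hε : ε = 1 ∨ ε = -1)
    (hg : AnalyticAt ℂ g 0) (hg0 : g 0 = 0) (hℓu : AnalyticAt ℂ ℓu 0) (hℓv : AnalyticAt ℂ ℓv 0)
    (hin : ∀ s : ℂ, 0 < ‖s‖ → ‖s‖ < ρ₀ → 𝔠[ε, e, A, g, ℓu, ℓv, s] ∈ W)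
    (hhit : ∀ δ : ℝ, 0 < δ → Set.Infinite {x | x ∈ indepExpPoints W ∧ ∃ ρ : ℝ, 0 < ρ ∧ ρ < δ ∧
      Sum.elim x (Complex.exp ∘ x) = 𝔠[ε, e, A, g, ℓu, ℓv, (ρ : ℂ)]}) :
    ∃ (A' : ℂ[X]) (g' ℓu' ℓv' : ℂ → ℂ), AnalyticAt ℂ g' 0 ∧ g' 0 = 0 ∧ AnalyticAt ℂ ℓu' 0 ∧
      AnalyticAt ℂ ℓv' 0 ∧
      (∀ s : ℂ, 0 < ‖s‖ → ‖s‖ < ρ₀ → 𝔠₁[e, A', g', ℓu', ℓv', s] ∈ W) ∧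
      ∀ δ : ℝ, 0 < δ → Set.Infinite {x | x ∈ indepExpPoints W ∧ ∃ ρ : ℝ, 0 < ρ ∧ ρ < δ ∧
        Sum.elim x (Complex.exp ∘ x) = 𝔠₁[e, A', g', ℓu', ℓv', (ρ : ℂ)]} := by
  rcases hε with rfl | rfl
  · -- `ε = 1`: nothing to do
    refine ⟨A, g, ℓu, ℓv, hg, hg0, hℓu, hℓv, fun s hs0 hsρ => ?_, fun δ hδ => ?_⟩
    · have := hin s hs0 hsρ
      simpa only [mul_one] using this
    · refine (hhit δ hδ).mono ?_
      rintro x ⟨hxH, ρ, hρ, hρδ, hpt⟩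
      refine ⟨hxH, ρ, hρ, hρδ, ?_⟩
      rw [hpt]; simp only [mul_one]
  · -- `ε = -1`: conjugate branch
    set A' : ℂ[X] := -A.map (starRingEnd ℂ) with hA'
    set g' : ℂ → ℂ := fun s => -conj (g (conj s)) with hg'
    set ℓu' : ℂ → ℂ := fun s => conj (ℓu (conj s)) with hℓu'
    set ℓv' : ℂ → ℂ := fun s => conj (ℓv (conj s)) with hℓv'
    have hconj : ∀ s : ℂ, (fun k => conj (𝔠[(-1 : ℂ), e, A, g, ℓu, ℓv, conj s] k)) =
        𝔠₁[e, A', g', ℓu', ℓv', s] := by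
      intro s
      funext k
      rcases k with k | k <;> fin_cases k
      · simp only [Sum.elim_inl, Fin.zero_eta, Fin.isValue, Matrix.cons_val_zero, map_add, map_mul,
          map_neg, map_one, map_pow, map_inv₀, Complex.conj_conj, map_ofNat, Complex.conj_ofReal,
          Complex.conj_I, hℓu']
        ring
      · simp only [Sum.elim_inl, Fin.mk_one, Fin.isValue, Matrix.cons_val_one, Matrix.cons_val_zero,
          map_add, map_mul, conj_eval, map_inv₀, Complex.conj_conj, map_ofNat, Complex.conj_ofReal,
          Complex.conj_I, hA', hg', hℓv', Polynomial.eval_neg]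
        ring
      · simp only [Sum.elim_inr, Fin.zero_eta, Fin.isValue, Matrix.cons_val_zero, ← Complex.exp_conj, hℓu']
      · simp only [Sum.elim_inr, Fin.mk_one, Fin.isValue, Matrix.cons_val_one, Matrix.cons_val_zero,
          ← Complex.exp_conj, hℓv']
    refine ⟨A', g', ℓu', ℓv', ?_, ?_, analyticAt_conj_conj hℓu, analyticAt_conj_conj hℓv,
      fun s hs0 hsρ => ?_, fun δ hδ => ?_⟩
    · exact (analyticAt_conj_conj hg).neg
    · simp [hg', hg0]
    · rw [← hconj s]
      exact conj_apply_mem_of_isDefinedOver_bot hW (hin (conj s) (by simpa using hs0) (by simpa using hsρ))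
    · have hinj : Set.InjOn (fun x : Fin 2 → ℂ => fun j => conj (x j)) Set.univ := by
        intro x _ y _ hxy
        funext j
        have := congrFun hxy j
        exact (starRingEnd ℂ).injective (by simpa using this)
      refine ((hhit δ hδ).image (hinj.mono (Set.subset_univ _))).mono ?_
      rintro _ ⟨x, ⟨hxH, ρ, hρ, hρδ, hpt⟩, rfl⟩
      refine ⟨conj_comp_mem_indepExpPoints hW hxH, ρ, hρ, hρδ, ?_⟩
      rw [← conj_sumElim_exp, hpt, ← hconj (ρ : ℂ), Complex.conj_ofReal]

end Literature.NumberTheory.Transcendental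

end
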